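import Literature.IUT.HodgeTheaters.ProfiniteCompletionFreeAbelianTorsionFree
import Literature.IUT.HodgeTheaters.TemperedCoveringsProp24InvLimit
import Literature.AnabelianGeometry.SemiGraphs.TemperedCurves
import HarnessLib

/-!
# A free profinite group is the profinite completion of the free group: the bridge from the L3
# predicate `IsFreeProfiniteOn` to the L5 completion model, and [IUTchI] Prop. 2.4 (i) sub-node (L2a)
# discharged from it

Mochizuki, *Inter-universal Teichmüller theory I*, kurims manuscript (May 2020), §2, proof of
Proposition 2.4 (i), p. 50 l. 27 ("`Δ̂_X` is strongly torsion-free") [cite: Mochizuki2012, Prop 2.4(i) p.50];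
[EtTh] §1 p. 12 "`Δ_X` is a profinite free group on 2 generators" [cite: MochizukiEtTh2009, §1 p.12]
(D-0012 claim key for [IUTchI]; nothing of the series is asserted here).  PROOF-ONLY file (seat
abc-iut-w4-d055; sub-DAG plan/L5/SUBDAG-IUTchI-Prop24.md, sub-row P24i.r4, third and last piece).

* `IsFreeProfiniteOn.exists_continuousMulEquiv_profiniteCompletion` — a compact totally
  disconnected group `P` that is free profinite on `x : ι → P` in the sense of abc-iut-L3-t2's
  `Literature.AnabelianGeometry.SemiGraphs.IsFreeProfiniteOn` (every family in a finite discrete group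
  is hit by exactly one continuous homomorphism) is isomorphic, as a topological group, to the profinite
  completion `Ĝ` of the free group `G = FreeGroup ι`, compatibly with `x` and `η ∘ FreeGroup.of`.  Proof:
  the universal property gives a coherent family of continuous maps `P → G/N`, i.e. a continuous
  homomorphism `ψ : P → Ĝ`; `ψ` is injective because every continuous finite quotient of `P` factors
  through some `G/N` (uniqueness clause), and surjective because its compact image contains the dense
  `η(G)`; a continuous bijection from a compact space to a Hausdorff space is a homeomorphism (so `P` is
  Hausdorff a posteriori).
* `StableCurveTemperedData.stronglyTorsionFreeSigma_of_isFreeProfiniteOn` — hence abc-iut-w5-d119's typed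
  sub-node `StronglyTorsionFreeSigma D` HOLDS whenever `Δ̂_X` is free profinite of finite rank
  (`IsFreeProfiniteOn D.DeltaHat x`, `ι` finite — the L3 datum, cf. `TemperedThetaQuotients.deltaHat_isFree`
  for the once-punctured case), `Δ̂_X` is closed and `Π̂_X` is totally disconnected: the
  composition of this bridge with `stronglyTorsionFreeSigma_of_mulEquiv_profiniteCompletion` (p418155)
  and `stronglyTorsionFreeSigma_of_torsionFreeAb` (p417014); capstone `prop24i_of_sub_of_isFreeProfiniteOn`
  (with abc-iut-L5-t11's tempered-inverse-limit reduction of (INV), `TemperedCoveringsProp24InvLimit.lean`).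

No new definition, no new Literature fact; nothing here bears on [IUTchIII] Cor. 3.12.
-/

namespace Literature.IUT.HodgeTheaters

open CategoryTheory ProfiniteGrp ProfiniteGrp.ProfiniteCompletion Topology
open Literature.AnabelianGeometry.SemiGraphs (IsFreeProfiniteOn)

universe u

/-- A homomorphism with open kernel into a discrete group is continuous. [folklore] -/
private theorem continuous_of_isOpen_ker' {P : Type*} [Group P] [TopologicalSpace P]
    [ContinuousMul P] {B : Type*} [Group B] [TopologicalSpace B] [DiscreteTopology B] (ψ : P →* B)
    (h : IsOpen ((ψ.ker : Subgroup P) : Set P)) : Continuous ψ := by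
  refine continuous_def.2 fun s _ => isOpen_iff_mem_nhds.2 fun x hx => ?_
  have ho : IsOpen ((fun y : P => x⁻¹ * y) ⁻¹' ((ψ.ker : Subgroup P) : Set P)) :=
    h.preimage (continuous_const.mul continuous_id)
  refine Filter.mem_of_superset (ho.mem_nhds (by simp)) fun y hy => ?_
  have hy' : ψ (x⁻¹ * y) = 1 := hy
  rw [map_mul, map_inv, inv_mul_eq_one] at hy'
  show ψ y ∈ s
  rw [← hy']
  exact hx

namespace ProfiniteCompletion

variable {ι : Type u} {P : Type u} [Group P] [TopologicalSpace P] [IsTopologicalGroup P]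
  [CompactSpace P] [TotallyDisconnectedSpace P]

/-- **A free profinite group on `x : ι → P` is the profinite completion of `FreeGroup ι`**, as a
topological group, compatibly with the generators. [cite: MochizukiEtTh2009, §1 p.12] -/
theorem _root_.Literature.AnabelianGeometry.SemiGraphs.IsFreeProfiniteOn.exists_continuousMulEquiv_profiniteCompletion
    {x : ι → P} (hx : IsFreeProfiniteOn P x) :
    ∃ e : P ≃ₜ* profiniteCompletion (FreeGroup ι),
      ∀ i, e (x i) = toCompletion (FreeGroup ι) (FreeGroup.of i) := by
  classical
  -- the finite discrete levels `Q N = G ⧸ N` of the completion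
  let G := FreeGroup ι
  let Q : FiniteIndexNormalSubgroup G → Type u := fun N => (diagram (GrpCat.of G)).obj N
  haveI hQd : ∀ N, DiscreteTopology (Q N) := fun N => ⟨rfl⟩
  haveI hQf : ∀ N, Finite (Q N) := fun N => inferInstanceAs (Finite (G ⧸ N.toSubgroup))
  -- the generators read in each level
  let a : ∀ N : FiniteIndexNormalSubgroup G, ι → Q N :=
    fun N i => (QuotientGroup.mk (FreeGroup.of i) : G ⧸ N.toSubgroup)
  -- the universal property: one continuous homomorphism per level
  have hex : ∀ N, ∃ f : P →ₜ* Q N, ∀ i, f (x i) = a N i := fun N => (hx (Q N) (a N)).exists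
  choose f hf using hex
  have huniq : ∀ N (g₁ g₂ : P →ₜ* Q N), (∀ i, g₁ (x i) = a N i) → (∀ i, g₂ (x i) = a N i) → g₁ = g₂ :=
    fun N g₁ g₂ h₁ h₂ => (hx (Q N) (a N)).unique h₁ h₂
  -- coherence of the family along the transition maps
  have hcoh : ∀ {N M : FiniteIndexNormalSubgroup G} (π : N ⟶ M) (p : P),
      (diagram (GrpCat.of G)).map π (f N p) = f M p := by
    intro N M π p
    let t : Q N →ₜ* Q M := ((diagram (GrpCat.of G)).map π).hom
    have ht : ∀ g : G, t (QuotientGroup.mk g : G ⧸ N.toSubgroup) = (QuotientGroup.mk g : G ⧸ M.toSubgroup) :=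
      fun g => rfl
    have := huniq M (t.comp (f N)) (f M) (fun i => by
      change t (f N (x i)) = a M i
      rw [hf N i]
      exact ht _) (hf M)
    exact congrArg (fun g : P →ₜ* Q M => g p) this
  -- the continuous homomorphism `ψ : P → Ĝ`
  let ψ : P →* profiniteCompletion G :=
    { toFun := fun p => ⟨fun N => f N p, fun {N M} π => hcoh π p⟩
      map_one' := by
        apply Subtype.ext; funext N
        exact map_one (f N)
      map_mul' := fun p q => by
        apply Subtype.ext; funext N
        exact map_mul (f N) p q }
  have hψval : ∀ (p : P) (N : FiniteIndexNormalSubgroup G), (ψ p).val N = f N p := fun p N => rfl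
  have hψc : Continuous ψ :=
    Continuous.subtype_mk (continuous_pi fun N => (f N).continuous) _
  -- `ψ ∘ (FreeGroup.lift x) = η`
  let φ : G →* P := FreeGroup.lift x
  have hψφ : ∀ g : G, ψ (φ g) = toCompletion G g := by
    have : ψ.comp φ = toCompletion G := by
      refine FreeGroup.ext_hom _ _ fun i => ?_
      apply Subtype.ext; funext N
      change f N (φ (FreeGroup.of i)) = (QuotientGroup.mk (FreeGroup.of i) : G ⧸ N.toSubgroup)
      rw [show φ (FreeGroup.of i) = x i from FreeGroup.lift_apply_of]
      exact hf N i
    intro g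
    exact congrArg (fun h : G →* profiniteCompletion G => h g) this
  -- `ψ` is injective: every continuous finite quotient of `P` factors through some level
  have hψinj : Function.Injective ψ := by
    rw [← MonoidHom.ker_eq_bot_iff, Subgroup.eq_bot_iff_forall]
    intro p hp
    rw [MonoidHom.mem_ker] at hp
    by_contra hp1
    obtain ⟨V, hV⟩ := ProfiniteGrp.exist_openNormalSubgroup_sub_open_nhds_of_one
      (isOpen_compl_singleton (x := p)) (by simpa using fun h => hp1 h.symm)
    have hpV : p ∉ V := fun h => hV h rfl
    -- the finite discrete quotient `P ⧸ V`
    letI : TopologicalSpace (P ⧸ V.toSubgroup) := ⊥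
    haveI : DiscreteTopology (P ⧸ V.toSubgroup) := ⟨rfl⟩
    haveI : Finite (P ⧸ V.toSubgroup) := Subgroup.quotient_finite_of_isOpen _ V.isOpen'
    let qV : P →ₜ* (P ⧸ V.toSubgroup) :=
      { toMonoidHom := QuotientGroup.mk' V.toSubgroup
        continuous_toFun := continuous_of_isOpen_ker' _ (by
          rw [QuotientGroup.ker_mk']; exact V.isOpen') }
    -- it factors through the level `N := Ker(FreeGroup.lift (qV ∘ x))`
    let g : G →* (P ⧸ V.toSubgroup) := FreeGroup.lift fun i => qV (x i)
    haveI : g.ker.FiniteIndex := by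
      apply Subgroup.finiteIndex_of_finite_quotient
    let N : FiniteIndexNormalSubgroup G := FiniteIndexNormalSubgroup.ofSubgroup g.ker
    let gbar : Q N →ₜ* (P ⧸ V.toSubgroup) :=
      { toMonoidHom := QuotientGroup.kerLift g
        continuous_toFun := continuous_of_discreteTopology }
    have hfac : gbar.comp (f N) = qV :=
      (hx (P ⧸ V.toSubgroup) (fun i => qV (x i))).unique
        (fun i => by
          change gbar (f N (x i)) = qV (x i)
          rw [hf N i]
          change QuotientGroup.kerLift g (QuotientGroup.mk (FreeGroup.of i)) = _
          rw [QuotientGroup.kerLift_mk, FreeGroup.lift_apply_of])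
        (fun i => rfl)
    have h1 : qV p = 1 := by
      have e1 : qV p = gbar (f N p) := by rw [← hfac]; rfl
      rw [e1, ← hψval, hp]
      exact map_one gbar
    exact hpV ((QuotientGroup.eq_one_iff p).1 h1)
  -- `ψ` is surjective: its compact image contains the dense `η(G)`
  have hψsurj : Function.Surjective ψ := by
    have hclosed : IsClosed (Set.range ψ) := (isCompact_range hψc).isClosed
    have hdense : ∀ y : profiniteCompletion G, y ∈ closure (Set.range (toCompletion G)) :=
      denseRange (GrpCat.of G)
    have hsub : Set.range (toCompletion G) ⊆ Set.range ψ := by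
      rintro _ ⟨g', rfl⟩
      exact ⟨φ g', hψφ g'⟩
    intro y
    have : y ∈ Set.range ψ := by
      rw [← hclosed.closure_eq]
      exact closure_mono hsub (hdense y)
    exact this
  -- assemble the isomorphism of topological groups
  let E : P ≃ profiniteCompletion G := Equiv.ofBijective ψ ⟨hψinj, hψsurj⟩
  let Eₜ : P ≃ₜ profiniteCompletion G := Continuous.homeoOfEquivCompactToT2 (f := E) hψc
  refine ⟨ContinuousMulEquiv.mk' Eₜ fun p q => map_mul ψ p q, fun i => ?_⟩
  change ψ (x i) = toCompletion G (FreeGroup.of i)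
  rw [← hψφ, FreeGroup.lift_apply_of]

end ProfiniteCompletion

/-! ### The L5 corollary: sub-row P24i.r4 from the L3 predicate -/

namespace StableCurveTemperedData

variable {D : StableCurveTemperedData.{u}}

/-- **[IUTchI] Prop. 2.4 (i), input "`Δ̂_X` is strongly torsion-free" DISCHARGED from the L3 datum
"`Δ̂_X` is free profinite of finite rank"**: if `Δ̂_X` is free profinite on a finite family
(`IsFreeProfiniteOn`, abc-iut-L3-t2 — the geometric fundamental group of an affine hyperbolic curve),
`Δ̂_X` is closed and `Π̂_X` is totally disconnected, then abc-iut-w5-d119's typed sub-node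
`StronglyTorsionFreeSigma D` holds. [cite: Mochizuki2012, Prop 2.4(i) p.50] -/
theorem stronglyTorsionFreeSigma_of_isFreeProfiniteOn [TotallyDisconnectedSpace D.PiHat]
    (hΔc : D.DeltaHatClosed) {ι : Type u} [Finite ι] {x : ι → D.DeltaHat}
    (hx : IsFreeProfiniteOn D.DeltaHat x) : D.StronglyTorsionFreeSigma := by
  haveI : CompactSpace D.DeltaHat := isCompact_iff_compactSpace.mp hΔc.isCompact
  obtain ⟨e, -⟩ := hx.exists_continuousMulEquiv_profiniteCompletion
  exact stronglyTorsionFreeSigma_of_mulEquiv_profiniteCompletion hΔc e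

/-- **[IUTchI] Prop. 2.4 (i) from the named sub-nodes, with (L2a) "`Δ̂_X` strongly torsion-free" DISCHARGED
at the free-profinite model and (INV) reduced to its tempered half** (abc-iut-L5-t11's
`prop24i_of_sub_of_inverseLimit`, p. 50 l. 40–42): the remaining inputs are the level bookkeeping, `Δ̂_X`
closed with `Δ^tp_X` dense in it, `Δ̂_X` free profinite of finite rank (`IsFreeProfiniteOn`), Prop. 2.1 at every
level, the `p ∉ Σ` abelianization comparison, the kernel monotonicity `hmono` and the tempered completeness
`hlim`. [cite: Mochizuki2012, Prop 2.4(i) p.50] -/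
theorem prop24i_of_sub_of_isFreeProfiniteOn [T2Space D.PiHat] [TotallyDisconnectedSpace D.PiHat]
    (T : D.Prop24Tower) (hΔc : D.DeltaHatClosed) (hd : D.DeltaHatDense)
    {ι : Type u} [Finite ι] {x : ι → D.DeltaHat} (hx : IsFreeProfiniteOn D.DeltaHat x)
    (hΔ : T.LevelsInDelta) (hn : T.LevelsNormal) (ho : T.LevelsOpen) (hcof : T.LevelsCofinal)
    (h21 : T.Prop21Levels) (hspec : T.SpecializationAb)
    (hmono : ∀ i j, T.Jhat j ≤ T.Jhat i →
      ((T.πhat j).ker.map (T.Jhat j).subtype) ≤ ((T.πhat i).ker.map (T.Jhat i).subtype))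
    (hlim : ∀ W : Subgroup D.PiHat, (∃ i, T.Jhat i ≤ W) → ∀ t : T.I → D.PiTp,
      (∀ i j, T.Jhat i ≤ W → T.Jhat j ≤ T.Jhat i →
        D.ιX ((t i)⁻¹ * t j) ∈ ((T.πhat i).ker.map (T.Jhat i).subtype)) →
      ∃ s : D.PiTp, ∀ i, T.Jhat i ≤ W → D.ιX (s⁻¹ * t i) ∈ ((T.πhat i).ker.map (T.Jhat i).subtype)) :
    D.Prop24i :=
  prop24i_of_sub_of_inverseLimit T hΔc hd (stronglyTorsionFreeSigma_of_isFreeProfiniteOn hΔc hx) hΔ hn ho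
    hcof h21 hspec hmono hlim

end StableCurveTemperedData

end Literature.IUT.HodgeTheaters
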